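import Literature.NumberTheory.EllipticCurves.KleinFrickeLevelSevenTorsion
import HarnessLib

/-!
# Crux `MazurKenkuBound` (stmt-ABC-15125), line radius-lite: stub `stub_hauptmodulSeven`

Klein–Fricke at level `7` from a torsion point, WITH the value of the Hauptmodul: for `W/F`
elliptic, `L/F` Galois and `P = (x, y) ∈ W(L)` of order `7` with `Gal(L/F)`-stable `ℤP`, the
tangent-normalised coefficients `A₁, A₂, A₃` of `W_L` at `P` (`WeierstrassCurve.tgA₁/₂/₃`) have
Kubert's shape `u(1 - d(d-1))`, `-u²d²(d-1)`, `-u³d²(d-1)` (`d = -A₂³/(A₃(A₃ - A₁A₂))` Tate's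
parameter of `X₁(7)`, `u = A₃/A₂`, `d(d-1) ≠ 0`), and there is `η ∈ F` with
`j(W) · η = (η² + 13η + 49)(η² + 5η + 1)³` and `η · d(d-1) = d³ - 8d² + 5d + 1`. A thin wrapper
around `WeierstrassCurve.hauptmodul_seven_of_torsion_some` of
`Literature/NumberTheory/EllipticCurves/KleinFrickeLevelSevenTorsion.lean`.
[cite: Kubert1976, Table 3 (N = 7)]
-/

set_option linter.dupNamespace false

noncomputable section

open scoped Classical

open WeierstrassCurve

namespace Summit.ABC.ABC.Theorems

/-- **Klein–Fricke at level `7` from a torsion point, with the value of the Hauptmodul.** For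
`W/F` elliptic, `L/F` Galois and `P = (x, y) ∈ W(L)` of order `7` with `Gal(L/F)`-stable `ℤP`:
`A₂A₃(A₃ - A₁A₂) ≠ 0` for the tangent-normalised coefficients of `W_L` at `P`, which have
Kubert's shape `A₁ = u(1 - d(d-1))`, `A₂ = -u²d²(d-1)`, `A₃ = -u³d²(d-1)`
(`d = -A₂³/(A₃(A₃ - A₁A₂))`, `u = A₃/A₂`, `d(d-1) ≠ 0`), and some `η ∈ F` satisfies
`j(W) · η = (η² + 13η + 49)(η² + 5η + 1)³` and `η · d(d-1) = d³ - 8d² + 5d + 1`.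
[cite: Kubert1976, Table 3 (N = 7)] -/
theorem stub_hauptmodulSeven :
    ∀ {F : Type} [Field F] {L : Type} [Field L] [Algebra F L] [IsGalois F L]
      (W : WeierstrassCurve F) [W.IsElliptic] {x y : L}
      {h : (W.baseChange L).toAffine.Nonsingular x y},
      addOrderOf (Affine.Point.some x y h : (W.baseChange L).toAffine.Point) = 7 →
      (∀ σ : L ≃ₐ[F] L, σ • (Affine.Point.some x y h : (W.baseChange L).toAffine.Point) ∈
          AddSubgroup.zmultiples (Affine.Point.some x y h : (W.baseChange L).toAffine.Point)) →
      (W.baseChange L).tgA₂ x y ≠ 0 ∧ (W.baseChange L).tgA₃ x y ≠ 0 ∧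
      (W.baseChange L).tgA₃ x y - (W.baseChange L).tgA₁ x y * (W.baseChange L).tgA₂ x y ≠ 0 ∧
      ∀ d u : L,
        d = -(W.baseChange L).tgA₂ x y ^ 3 /
              ((W.baseChange L).tgA₃ x y *
                ((W.baseChange L).tgA₃ x y - (W.baseChange L).tgA₁ x y * (W.baseChange L).tgA₂ x y)) →
        u = (W.baseChange L).tgA₃ x y / (W.baseChange L).tgA₂ x y →
        d ≠ 0 ∧ d - 1 ≠ 0 ∧
        (W.baseChange L).tgA₁ x y = u * (1 - d * (d - 1)) ∧
        (W.baseChange L).tgA₂ x y = -(u ^ 2 * (d ^ 2 * (d - 1))) ∧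
        (W.baseChange L).tgA₃ x y = -(u ^ 3 * (d ^ 2 * (d - 1))) ∧
        ∃ η : F, W.j * η = (η ^ 2 + 13 * η + 49) * (η ^ 2 + 5 * η + 1) ^ 3 ∧
          algebraMap F L η * (d * (d - 1)) = d ^ 3 - 8 * d ^ 2 + 5 * d + 1 := by
  intro F _ L _ _ _ W _ x y h h7 hσ
  exact hauptmodul_seven_of_torsion_some (W := W) h7 hσ

end Summit.ABC.ABC.Theorems

end
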